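import Summits.AnomalousDissipation.AnomalousDissipation.Theorems.SolenoidalFractalHomogenisationLagrangianCarrierConstructionFlowSmooth
import Literature.Analysis.FunctionSpaces.FlatTorusProofs
import Mathlib.Analysis.Calculus.ContDiff.Basic
import Mathlib.Analysis.Calculus.MeanValue
import HarnessLib

/-!
# K3L `LagrangianCarrierConstruction` (stmt-AnomalousDissipation-24913), line `birth`, stub `stub_flowsL`:
# refresh windows, accumulated window maps and equivariant bounds (helper; `--supports stmt-AnomalousDissipation-24913`)

Summits-side helper file (everything proved; no definitions, no named facts). Fifth brick of the Lagrangian insertion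
`stub_flowsL`:
* `exists_int_chain` — given window-to-window transition maps `M j : V ≃ V`, `j ∈ ℤ`, there is an accumulated family
  `C : ℤ → V ≃ V` with `C 0 = id` and `C (j+1) = M j ∘ C j` for ALL integers `j` (two-sided recursion), the bookkeeping of the
  absolute Lagrangian flow across the refresh windows `[jR, (j+1)R)`;
* window arithmetic for a window length `R > 0`: every time has a closed window on its right and one on its left, and a
  two-sided one when it is not a multiple of `R`;
* continuous lattice-periodic functions are bounded, on `ℝ^d` and on compact time slabs; hence a lattice-EQUIVARIANT `C¹`
  map has bounded derivative and is Lipschitz;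
* the space derivative of a jointly `C¹` two-variable map is jointly continuous;
* joint smoothness of the evolution map of `…FlowSmooth` in the INITIAL time and point on smooth slabs (backward reading of
  the group law), complementing `contDiffOn_evolutionMap_uncurry_of_local`.
Infrastructure for the construction side of route-1's rung leaf F-D1.A0 (a frontier formal rung); NOT a proof of anomalous
dissipation.
-/

set_option linter.dupNamespace false

noncomputable section

namespace Summit.AnomalousDissipation.AnomalousDissipation.Theorems.SolenoidalFractalHomogenisation.LagrangianCarrierConstruction

open Set Function Filter Topology Metric
open scoped NNReal
open Literature.Analysis.ODE Literature.Analysis.FunctionSpaces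

/-! ## Two-sided recursion along the windows -/

section Chain

variable {α : Type*}

/-- **Accumulated window maps.** For transition maps `M j : α ≃ α` there is `C : ℤ → α ≃ α` with `C 0 = id` and
`C (j + 1) = (C j).trans (M j)` for every integer `j` (forward recursion for `j ≥ 0`, backward through the inverses for
`j < 0`). [folklore] -/
theorem exists_int_chain (M : ℤ → α ≃ α) :
    ∃ C : ℤ → α ≃ α, C 0 = Equiv.refl α ∧ ∀ j : ℤ, C (j + 1) = (C j).trans (M j) := by
  let Cp : ℕ → α ≃ α := fun n => Nat.rec (Equiv.refl α) (fun n c => c.trans (M n)) n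
  let Cn : ℕ → α ≃ α := fun n => Nat.rec (Equiv.refl α) (fun n c => c.trans (M (-((n : ℤ) + 1))).symm) n
  have hCp : ∀ n : ℕ, Cp (n + 1) = (Cp n).trans (M n) := fun n => rfl
  have hCn : ∀ n : ℕ, Cn (n + 1) = (Cn n).trans (M (-((n : ℤ) + 1))).symm := fun n => rfl
  refine ⟨fun j => Int.rec Cp (fun n => Cn (n + 1)) j, rfl, fun j => ?_⟩
  cases j with
  | ofNat n =>
    show Cp (n + 1) = (Cp n).trans (M n)
    exact hCp n
  | negSucc n =>
    cases n with
    | zero =>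
      show Cp 0 = (Cn (0 + 1)).trans (M (Int.negSucc 0))
      have e0 : (-(((0 : ℕ) : ℤ) + 1)) = Int.negSucc 0 := by decide
      rw [hCn 0, e0, Equiv.trans_assoc, Equiv.symm_trans_self, Equiv.trans_refl]
      rfl
    | succ n =>
      show Cn (n + 1) = (Cn (n + 1 + 1)).trans (M (Int.negSucc (n + 1)))
      have e : (-(((n + 1 : ℕ) : ℤ) + 1)) = Int.negSucc (n + 1) := by
        rw [Int.negSucc_eq]
      rw [hCn (n + 1), e, Equiv.trans_assoc, Equiv.symm_trans_self, Equiv.trans_refl]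

end Chain

/-! ## Window arithmetic -/

section Windows

variable {R : ℝ}

/-- Every time lies in the closed window `[⌊t/R⌋R, (⌊t/R⌋+1)R]`, strictly before its right end. [folklore] -/
theorem floor_window (hR : 0 < R) (t : ℝ) :
    (⌊t / R⌋ : ℝ) * R ≤ t ∧ t < ((⌊t / R⌋ : ℝ) + 1) * R := by
  constructor
  · have := Int.floor_le (t / R)
    calc (⌊t / R⌋ : ℝ) * R ≤ t / R * R := mul_le_mul_of_nonneg_right this hR.le
      _ = t := div_mul_cancel₀ t hR.ne'
  · have := Int.lt_floor_add_one (t / R)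
    calc t = t / R * R := (div_mul_cancel₀ t hR.ne').symm
      _ < ((⌊t / R⌋ : ℝ) + 1) * R := mul_lt_mul_of_pos_right this hR

/-- On the half-open window `[jR, (j+1)R)` the window index is `j`. [folklore] -/
theorem floor_eq_of_mem_Ico (hR : 0 < R) {j : ℤ} {t : ℝ} (ht : t ∈ Ico ((j : ℝ) * R) (((j : ℝ) + 1) * R)) :
    ⌊t / R⌋ = j := by
  rw [Int.floor_eq_iff]
  exact ⟨(le_div_iff₀ hR).2 ht.1, (div_lt_iff₀ hR).2 ht.2⟩

/-- A right neighbourhood `[t, t+ε]` inside the closed window of `t`. [folklore] -/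
theorem exists_Icc_right_subset_window (hR : 0 < R) (t : ℝ) :
    ∃ ε > 0, Icc t (t + ε) ⊆ Icc ((⌊t / R⌋ : ℝ) * R) (((⌊t / R⌋ : ℝ) + 1) * R) := by
  obtain ⟨h1, h2⟩ := floor_window hR t
  exact ⟨((⌊t / R⌋ : ℝ) + 1) * R - t, by linarith, fun s hs => ⟨le_trans h1 hs.1, by linarith [hs.2]⟩⟩

/-- A left neighbourhood `[t−ε, t]` inside the closed window `[j'R, (j'+1)R]`, `j' = ⌈t/R⌉ − 1` (the previous window when
`t` is a window boundary). [folklore] -/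
theorem exists_Icc_left_subset_window (hR : 0 < R) (t : ℝ) :
    ∃ ε > 0, Icc (t - ε) t ⊆ Icc (((⌈t / R⌉ - 1 : ℤ) : ℝ) * R) ((((⌈t / R⌉ - 1 : ℤ) : ℝ) + 1) * R) := by
  have h1 : (((⌈t / R⌉ - 1 : ℤ) : ℝ)) * R < t := by
    have := Int.ceil_lt_add_one (t / R)
    have h : ((⌈t / R⌉ - 1 : ℤ) : ℝ) < t / R := by push_cast; linarith
    calc (((⌈t / R⌉ - 1 : ℤ) : ℝ)) * R < t / R * R := mul_lt_mul_of_pos_right h hR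
      _ = t := div_mul_cancel₀ t hR.ne'
  have h2 : t ≤ ((((⌈t / R⌉ - 1 : ℤ) : ℝ)) + 1) * R := by
    have := Int.le_ceil (t / R)
    have h : t / R ≤ (((⌈t / R⌉ - 1 : ℤ) : ℝ)) + 1 := by push_cast; linarith
    calc t = t / R * R := (div_mul_cancel₀ t hR.ne').symm
      _ ≤ ((((⌈t / R⌉ - 1 : ℤ) : ℝ)) + 1) * R := mul_le_mul_of_nonneg_right h hR.le
  exact ⟨t - (((⌈t / R⌉ - 1 : ℤ) : ℝ)) * R, by linarith, fun s hs => ⟨by linarith [hs.1], le_trans hs.2 h2⟩⟩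

/-- A two-sided neighbourhood inside the open window when `t` is not a window boundary. [folklore] -/
theorem exists_Icc_subset_Ioo_window (hR : 0 < R) {t : ℝ} (ht : ∀ j : ℤ, t ≠ (j : ℝ) * R) :
    ∃ ε > 0, Icc (t - ε) (t + ε) ⊆ Ioo ((⌊t / R⌋ : ℝ) * R) (((⌊t / R⌋ : ℝ) + 1) * R) := by
  obtain ⟨h1, h2⟩ := floor_window hR t
  have h1' : (⌊t / R⌋ : ℝ) * R < t := lt_of_le_of_ne h1 (fun h => ht ⌊t / R⌋ h.symm)
  refine ⟨min (t - (⌊t / R⌋ : ℝ) * R) (((⌊t / R⌋ : ℝ) + 1) * R - t) / 2, by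
    have := lt_min (sub_pos.2 h1') (sub_pos.2 h2); linarith, fun s hs => ⟨?_, ?_⟩⟩
  · have := min_le_left (t - (⌊t / R⌋ : ℝ) * R) (((⌊t / R⌋ : ℝ) + 1) * R - t)
    linarith [hs.1]
  · have := min_le_right (t - (⌊t / R⌋ : ℝ) * R) (((⌊t / R⌋ : ℝ) + 1) * R - t)
    linarith [hs.2]

/-- The window boundaries form a countable set. [folklore] -/
theorem countable_window_boundaries (R : ℝ) : {t : ℝ | ∃ j : ℤ, t = (j : ℝ) * R}.Countable := by
  have : {t : ℝ | ∃ j : ℤ, t = (j : ℝ) * R} = range fun j : ℤ => (j : ℝ) * R := by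
    ext t; simp [eq_comm]
  rw [this]
  exact countable_range _

end Windows

/-! ## Lattice-periodic functions are bounded; equivariant `C¹` maps have bounded derivative -/

section Periodic

variable {d : Type*} [Fintype d] [DecidableEq d]
variable {F : Type*} [NormedAddCommGroup F]

omit [DecidableEq d] in
/-- The closed unit cube of `ℝ^d` is compact. [folklore] -/
theorem isCompact_closedUnitCube : IsCompact {y : EuclideanSpace ℝ d | ∀ i, y i ∈ Icc (0 : ℝ) 1} := by
  refine Metric.isCompact_of_isClosed_isBounded ?_ ?_
  · have : {y : EuclideanSpace ℝ d | ∀ i, y i ∈ Icc (0 : ℝ) 1} = ⋂ i, (fun y : EuclideanSpace ℝ d => y i) ⁻¹' Icc 0 1 := by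
      ext y; simp
    rw [this]
    exact isClosed_iInter fun i => isClosed_Icc.preimage (EuclideanSpace.proj i).continuous
  · refine (Metric.isBounded_iff_subset_closedBall (0 : EuclideanSpace ℝ d)).2 ⟨Real.sqrt (Fintype.card d), fun y hy => ?_⟩
    rw [mem_closedBall, dist_zero_right, EuclideanSpace.norm_eq]
    refine Real.sqrt_le_sqrt ?_
    calc ∑ i, ‖y i‖ ^ 2 ≤ ∑ _i : d, (1 : ℝ) := Finset.sum_le_sum fun i _ => by
            have h := hy i
            rw [Real.norm_eq_abs, abs_of_nonneg h.1]
            nlinarith [h.1, h.2]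
      _ = Fintype.card d := by simp

/-- **A continuous lattice-periodic function on `ℝ^d` is bounded** (it factors through the compact torus: reduce to the
representative in the unit cube). [folklore] -/
theorem exists_bound_of_isLatticePeriodic {g : EuclideanSpace ℝ d → F} (hg : Torus.IsLatticePeriodic g)
    (hc : Continuous g) : ∃ C, ∀ x, ‖g x‖ ≤ C := by
  obtain ⟨C, hC⟩ := isCompact_closedUnitCube.exists_bound_of_continuousOn (f := g) hc.continuousOn
  refine ⟨C, fun x => ?_⟩
  have hx : g x = g (Torus.repr (Torus.proj x)) :=
    Torus.IsLatticePeriodic.eq_of_proj_eq_holds hg (Torus.proj_repr (Torus.proj x)).symm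
  rw [hx]
  exact hC _ fun i => Ico_subset_Icc_self (Torus.repr_mem_unitCube (Torus.proj x) i)

/-- A jointly continuous field on a compact time slab `[a, b] × ℝ^d` which is lattice periodic in space at each time is
bounded there. [folklore] -/
theorem exists_bound_slab_of_isLatticePeriodic {w : ℝ → EuclideanSpace ℝ d → F} {a b : ℝ}
    (hw : ContinuousOn (uncurry w) (Icc a b ×ˢ univ)) (hper : ∀ t ∈ Icc a b, Torus.IsLatticePeriodic (w t)) :
    ∃ C, ∀ t ∈ Icc a b, ∀ x, ‖w t x‖ ≤ C := by
  have hKc : IsCompact (Icc a b ×ˢ {y : EuclideanSpace ℝ d | ∀ i, y i ∈ Icc (0 : ℝ) 1}) :=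
    isCompact_Icc.prod isCompact_closedUnitCube
  obtain ⟨C, hC⟩ := hKc.exists_bound_of_continuousOn (hw.mono (prod_mono le_rfl (subset_univ _)))
  refine ⟨C, fun t ht x => ?_⟩
  have hx : w t x = w t (Torus.repr (Torus.proj x)) :=
    Torus.IsLatticePeriodic.eq_of_proj_eq_holds (hper t ht) (Torus.proj_repr (Torus.proj x)).symm
  rw [hx]
  have := hC (t, Torus.repr (Torus.proj x)) ⟨ht, fun i => Ico_subset_Icc_self (Torus.repr_mem_unitCube _ i)⟩
  simpa [uncurry] using this

/-- The derivative of a lattice-equivariant map is lattice periodic (basis-vector form). [folklore] -/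
theorem isLatticePeriodic_fderiv_of_equivariant {G : EuclideanSpace ℝ d → EuclideanSpace ℝ d}
    (hG : ∀ z (k : d → ℤ), G (z + Torus.latticeVec k) = G z + Torus.latticeVec k) :
    Torus.IsLatticePeriodic (fderiv ℝ G) := by
  intro j z
  have h := fderiv_add_latticeVec_of_equivariant hG z (Pi.single j 1)
  rwa [Torus.latticeVec_single] at h

/-- **A lattice-equivariant `C¹` map has bounded derivative.** [folklore] -/
theorem exists_bound_fderiv_of_equivariant {G : EuclideanSpace ℝ d → EuclideanSpace ℝ d} (hG1 : ContDiff ℝ 1 G)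
    (hG : ∀ z (k : d → ℤ), G (z + Torus.latticeVec k) = G z + Torus.latticeVec k) :
    ∃ C, ∀ z, ‖fderiv ℝ G z‖ ≤ C :=
  exists_bound_of_isLatticePeriodic (isLatticePeriodic_fderiv_of_equivariant hG) (hG1.continuous_fderiv (by simp))

/-- A lattice-equivariant `C¹` map is Lipschitz. [folklore] -/
theorem exists_lipschitzWith_of_equivariant {G : EuclideanSpace ℝ d → EuclideanSpace ℝ d} (hG1 : ContDiff ℝ 1 G)
    (hG : ∀ z (k : d → ℤ), G (z + Torus.latticeVec k) = G z + Torus.latticeVec k) :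
    ∃ K : ℝ≥0, LipschitzWith K G := by
  obtain ⟨C, hC⟩ := exists_bound_fderiv_of_equivariant hG1 hG
  refine ⟨C.toNNReal, lipschitzWith_of_nnnorm_fderiv_le (hG1.differentiable (by simp)) fun z => ?_⟩
  have h := hC z
  rw [← NNReal.coe_le_coe, coe_nnnorm, Real.coe_toNNReal']
  exact h.trans (le_max_left _ _)

end Periodic

/-! ## Slices of jointly `C¹` maps -/

section Slice

variable {V : Type*} [NormedAddCommGroup V] [NormedSpace ℝ V]

/-- The space derivative of the slice of a jointly differentiable map is the full derivative composed with the
inclusion of the space factor. [folklore] -/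
theorem fderiv_slice_eq {Φ : ℝ → V → V} {t : ℝ} {z : V}
    (h : DifferentiableAt ℝ (fun q : ℝ × V => Φ q.1 q.2) (t, z)) :
    fderiv ℝ (Φ t) z = (fderiv ℝ (fun q : ℝ × V => Φ q.1 q.2) (t, z)).comp (ContinuousLinearMap.inr ℝ ℝ V) := by
  have h2 : HasFDerivAt (fun z => Φ t z) ((fderiv ℝ (fun q : ℝ × V => Φ q.1 q.2) (t, z)).comp
      (ContinuousLinearMap.inr ℝ ℝ V)) z :=
    HasFDerivAt.comp z h.hasFDerivAt (hasFDerivAt_prodMk_right t z)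
  exact h2.fderiv

/-- **The space derivative of a jointly `C¹` map is jointly continuous.** [folklore] -/
theorem continuousAt_fderiv_slice {Φ : ℝ → V → V} {p : ℝ × V} {n : WithTop ℕ∞}
    (h : ContDiffAt ℝ n (fun q : ℝ × V => Φ q.1 q.2) p) (hn : 1 ≤ n) :
    ContinuousAt (fun q : ℝ × V => fderiv ℝ (Φ q.1) q.2) p := by
  have h1 : ContDiffAt ℝ 1 (fun q : ℝ × V => Φ q.1 q.2) p := h.of_le hn
  have hev : ∀ᶠ q in 𝓝 p, ContDiffAt ℝ 1 (fun q : ℝ × V => Φ q.1 q.2) q := h1.eventually (by simp)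
  have hcont : ContinuousAt (fun q : ℝ × V => (fderiv ℝ (fun q : ℝ × V => Φ q.1 q.2) q).comp
      (ContinuousLinearMap.inr ℝ ℝ V)) p :=
    (h1.continuousAt_fderiv (by norm_num)).clm_comp continuousAt_const
  refine hcont.congr (hev.mono fun q hq => ?_)
  obtain ⟨t', z'⟩ := q
  exact (fderiv_slice_eq (hq.differentiableAt (by simp))).symm

end Slice

/-! ## Evolution maps: joint smoothness in the initial time -/

section Initial

variable {V : Type*} [NormedAddCommGroup V] [NormedSpace ℝ V] [CompleteSpace V]
variable {v : ℝ → V → V} {n : ℕ∞}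

/-- **Joint smoothness of `(s, z) ↦ φ(t, s, z)` in the initial time and point on a smooth slab**, for every target time
`t`: route the group law backwards through a time `r ∈ S`, `φ(t, s, ·) = φ(t, r, ·) ∘ φ(r, s, ·)`. [folklore] -/
theorem contDiffOn_evolutionMap_initial_of_local (hv : IsUniformlyLipschitzOn v univ) (hn : 1 ≤ n)
    (hloc : ∀ r : ℝ, ∃ ε > 0, ContDiffOn ℝ n (uncurry v) (Icc r (r + ε) ×ˢ univ) ∧
      ContDiffOn ℝ n (uncurry v) (Icc (r - ε) r ×ˢ univ))
    {S : Set ℝ} (hS : Convex ℝ S) (hSu : UniqueDiffOn ℝ S) (hvS : ContDiffOn ℝ n (uncurry v) (S ×ˢ univ))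
    {r : ℝ} (hr : r ∈ S) (t : ℝ) :
    ContDiffOn ℝ n (fun p : ℝ × V => evolutionMap v p.1 t p.2) (S ×ˢ univ) := by
  have h3 := (hv.mono (subset_univ S)).contDiffOn_evolutionMap hS hSu hn hvS
  -- `(s, z) ↦ φ(r, s, z)` is `C^n` on `S × V`
  have hg : ContDiffOn ℝ n (fun p : ℝ × V => ((p.1, r, p.2) : ℝ × ℝ × V)) (S ×ˢ univ) :=
    (contDiff_fst.prodMk (contDiff_const.prodMk contDiff_snd)).contDiffOn
  have hmaps : MapsTo (fun p : ℝ × V => ((p.1, r, p.2) : ℝ × ℝ × V)) (S ×ˢ univ) (S ×ˢ S ×ˢ univ) :=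
    fun p hp => ⟨hp.1, hr, mem_univ _⟩
  have h1 : ContDiffOn ℝ n (fun p : ℝ × V => evolutionMap v p.1 r p.2) (S ×ˢ univ) := h3.comp hg hmaps
  have hE : ContDiff ℝ n (evolutionMap v r t) := contDiff_evolutionMap_of_local hv hn hloc r t
  refine ((hE.comp_contDiffOn h1)).congr fun p _ => ?_
  simp only [comp_apply]
  exact (evolutionMap_trans_univ hv p.1 r t p.2).symm

/-- Joint `C^n`-ness of `(s, z) ↦ φ(t, s, z)` at `(s, z)` when the field is `C^n` on a two-sided slab around `s`.
[folklore] -/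
theorem contDiffAt_evolutionMap_initial_of_local (hv : IsUniformlyLipschitzOn v univ) (hn : 1 ≤ n)
    (hloc : ∀ r : ℝ, ∃ ε > 0, ContDiffOn ℝ n (uncurry v) (Icc r (r + ε) ×ˢ univ) ∧
      ContDiffOn ℝ n (uncurry v) (Icc (r - ε) r ×ˢ univ))
    {s ε : ℝ} (hε : 0 < ε) (h2 : ContDiffOn ℝ n (uncurry v) (Icc (s - ε) (s + ε) ×ˢ univ)) (t : ℝ) (z : V) :
    ContDiffAt ℝ n (fun p : ℝ × V => evolutionMap v p.1 t p.2) (s, z) := by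
  have hs : s ∈ Icc (s - ε) (s + ε) := ⟨by linarith, by linarith⟩
  have h := contDiffOn_evolutionMap_initial_of_local hv hn hloc (convex_Icc _ _)
    (uniqueDiffOn_Icc (by linarith)) h2 hs t
  exact h.contDiffAt (prod_mem_nhds (Icc_mem_nhds (by linarith) (by linarith)) univ_mem)

end Initial

end Summit.AnomalousDissipation.AnomalousDissipation.Theorems.SolenoidalFractalHomogenisation.LagrangianCarrierConstruction

end
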